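import Summits.AtomisticToContinuum.BoseEinsteinCondensation.Theorems.BECThomsonPrincipleFibreConductanceConditionalDefs
import Summits.AtomisticToContinuum.BoseEinsteinCondensation.Theorems.BECThomsonPrincipleFibreConductanceStubLocalChargeSq
import Literature.MathematicalPhysics.QuantumManyBody.JelliumBochnerFibre
import HarnessLib

/-!
# Route `BECThomsonPrinciple`, crux `FibreConductance` (stmt-AtomisticToContinuum-9480),
# line `conditional-law-poincare` — stub `stub_localToGlobal`, part I: cube data and cube neutrality

Infrastructure for `stub_localToGlobal` (part II, `…StubLocalToGlobal.lean`) over the vocabulary of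
`…FibreConductanceConditionalDefs` (generic continuous charge `ρ`, block count `ν`):

* cube data: `cubeMass`, `cubeChargeOf` are fibre constants and continuous in the configuration,
  `μ_Q > 0` (`ψ` is bounded below; `|Q| = ℓ³` is `volume_cubeSet` of `…StubLocalChargeSq`);
* the coarse part `ρ_c = ψ²c_Q/μ_Q` is the continuous branch selected by the measurable cube index of
  `x₀`: measurability of `ρ_c`, `ρ_loc`, integrability on `cellN` of `ρ_c·G`, `ρ_loc·G` (`G` continuous)
  and of `ρ_loc·Πη` (`Πη` the flat block average);
* CUBE NEUTRALITY `∫_Q ρ_loc(y, X̂) dy = c_Q − (c_Q/μ_Q)·μ_Q = 0` (`integral_cubeSet_localOf`), the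
  fibrewise vanishing `∫_cell ρ_loc·Πη dy = 0` and, by Bochner fibre Fubini
  (`integral_cellN_integral_cell_update`), THE CROSS TERM VANISHES: `∫_{cellN} ρ_loc·Πη = 0`
  (`integral_localOf_mul_blockAvg`).

Helper names carry the prefix `ltg_`. All [folklore] (elementary measure theory on the torus).
-/

noncomputable section

namespace Summit.AtomisticToContinuum.BoseEinsteinCondensation.Cruxes.FibreConductance.ConditionalLawPoincare

open MeasureTheory
open scoped ENNReal
open Literature.MathematicalPhysics.QuantumManyBody.BoseGas
open Summit.AtomisticToContinuum.BoseEinsteinCondensation.Cruxes.FibreConductance.ParsevalShellBootstrap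
open Summit.AtomisticToContinuum.BoseEinsteinCondensation.Cruxes.FibreConductance.HealingSplitKineticDefect

variable {m : ℕ} {L : ℝ}

/-! ## `stub_localToGlobal` — LOCAL-TO-GLOBAL IN DUAL FORM (generic in a continuous charge)

The flat block average `Πη(X) = ⨍_{Q(x₀)} η(·, X̂)` is written `cubeAvg L ν η (cubeIdx L ν (X 0)) X`
(`blockAvg` of the sibling files); helper names of this file carry the prefix `ltg_`. -/

section LocalToGlobal

open Set

/-! ### Cube data: fibre constancy, continuity, positivity -/

/-- The cube mass is constant along the fibre. [folklore] -/
theorem cubeMass_update (L : ℝ) (ν : ℕ) (Φ : PeriodicTrialState (m + 1) L) (Q : Fin 3 → Fin (ν + 1))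
    (X : Config (m + 1)) (y : Space) : cubeMass L ν Φ Q (Function.update X 0 y) = cubeMass L ν Φ Q X := by
  simp only [cubeMass, Function.update_idem]

/-- The cube charge is constant along the fibre. [folklore] -/
theorem cubeChargeOf_update (L : ℝ) (ν : ℕ) (ρ : Config (m + 1) → ℂ) (Q : Fin 3 → Fin (ν + 1))
    (X : Config (m + 1)) (y : Space) :
    cubeChargeOf L ν ρ Q (Function.update X 0 y) = cubeChargeOf L ν ρ Q X := by
  simp only [cubeChargeOf, Function.update_idem]

/-- The cube mass depends continuously on the configuration. [folklore] -/
theorem continuous_cubeMass (hL : 0 < L) (ν : ℕ) (Φ : PeriodicTrialState (m + 1) L)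
    (hΦ : ∀ X, Φ.ψ X ≠ 0) (Q : Fin 3 → Fin (ν + 1)) : Continuous (cubeMass L ν Φ Q) := by
  unfold cubeMass
  exact continuous_parametric_setIntegral_of_isBounded (μ := volume)
    ((isBounded_cell L).subset (cubeSet_subset_cell hL Q)) (measurableSet_cubeSet L ν Q)
    (((continuous_fibrePsi hL Φ hΦ).comp continuous_update_zero).pow 2)

/-- The cube charge of a continuous charge depends continuously on the configuration. [folklore] -/
theorem continuous_cubeChargeOf (hL : 0 < L) (ν : ℕ) {ρ : Config (m + 1) → ℂ} (hρ : Continuous ρ)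
    (Q : Fin 3 → Fin (ν + 1)) : Continuous (cubeChargeOf L ν ρ Q) := by
  unfold cubeChargeOf
  exact continuous_parametric_setIntegral_of_isBounded (μ := volume)
    ((isBounded_cell L).subset (cubeSet_subset_cell hL Q)) (measurableSet_cubeSet L ν Q)
    (hρ.comp continuous_update_zero)

/-- The cube mass is positive (`ψ` is bounded below by a positive constant). [folklore] -/
theorem cubeMass_pos (hL : 0 < L) (ν : ℕ) (Φ : PeriodicTrialState (m + 1) L) (hΦ : ∀ X, Φ.ψ X ≠ 0)
    (Q : Fin 3 → Fin (ν + 1)) (X : Config (m + 1)) : 0 < cubeMass L ν Φ Q X := by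
  obtain ⟨c, C, hc, hcψ, -, -, -⟩ := exists_fibre_bounds hL Φ hΦ
  have hcont : Continuous fun y : Space => fibrePsi Φ (Function.update X 0 y) ^ 2 :=
    ((continuous_fibrePsi hL Φ hΦ).comp (continuous_const.update 0 continuous_id)).pow 2
  have hvol : (volume.restrict (cubeSet L ν Q)).real univ = side L ν ^ 3 := by
    rw [measureReal_restrict_apply_univ]; exact volume_real_cubeSet hL ν Q
  haveI : IsFiniteMeasure (volume.restrict (cubeSet L ν Q)) := by
    refine ⟨?_⟩
    rw [Measure.restrict_apply_univ, volume_cubeSet L]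
    exact ENNReal.pow_lt_top ENNReal.ofReal_lt_top
  have hle : ∫ _ in cubeSet L ν Q, c ^ 2 ≤ cubeMass L ν Φ Q X := by
    unfold cubeMass
    refine integral_mono (integrable_const _) (integrableOn_cubeSet hL Q hcont) fun y => ?_
    exact pow_le_pow_left₀ hc.le (hcψ _) 2
  have hconst : ∫ _ in cubeSet L ν Q, c ^ 2 = side L ν ^ 3 * c ^ 2 := by
    rw [setIntegral_const, smul_eq_mul, ← measureReal_restrict_apply_univ, hvol]
  have hpos : 0 < side L ν ^ 3 * c ^ 2 := by have := side_pos hL ν; positivity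
  linarith

/-! ### The coarse / local parts: branches, measurability, integrability -/

variable {ρ : Config (m + 1) → ℂ}

/-- The `Q`-branch `F_Q(X) = ψ(X)²·c_Q(X̂)/μ_Q(X̂)` of the coarse part (continuous). [folklore] -/
theorem ltg_continuous_branch (hL : 0 < L) (ν : ℕ) (Φ : PeriodicTrialState (m + 1) L)
    (hΦ : ∀ X, Φ.ψ X ≠ 0) (hρ : Continuous ρ) (Q : Fin 3 → Fin (ν + 1)) :
    Continuous fun X => ((fibrePsi Φ X ^ 2 : ℝ) : ℂ) *
      (cubeChargeOf L ν ρ Q X / (cubeMass L ν Φ Q X : ℂ)) := by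
  have hψ := continuous_fibrePsi hL Φ hΦ
  have hc := continuous_cubeChargeOf hL ν hρ Q
  have hμ := continuous_cubeMass hL ν Φ hΦ Q
  have hμ0 : ∀ X, (cubeMass L ν Φ Q X : ℂ) ≠ 0 := fun X =>
    Complex.ofReal_ne_zero.2 (cubeMass_pos hL ν Φ hΦ Q X).ne'
  exact (Complex.continuous_ofReal.comp (hψ.pow 2)).mul
    (hc.div (Complex.continuous_ofReal.comp hμ) hμ0)

/-- The coarse part is the branch selected by the cube index of `x₀`. [folklore] -/
theorem coarseOf_eq_branch (L : ℝ) (ν : ℕ) (Φ : PeriodicTrialState (m + 1) L) (ρ : Config (m + 1) → ℂ)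
    (X : Config (m + 1)) :
    coarseOf L ν Φ ρ X = (fun Q X => ((fibrePsi Φ X ^ 2 : ℝ) : ℂ) *
      (cubeChargeOf L ν ρ Q X / (cubeMass L ν Φ Q X : ℂ))) (cubeIdx L ν (X 0)) X := rfl

/-- The coarse part of a continuous charge is measurable. [folklore] -/
theorem measurable_coarseOf (hL : 0 < L) (ν : ℕ) (Φ : PeriodicTrialState (m + 1) L)
    (hΦ : ∀ X, Φ.ψ X ≠ 0) (hρ : Continuous ρ) : Measurable (coarseOf L ν Φ ρ) :=
  measurable_select (F := fun Q X => ((fibrePsi Φ X ^ 2 : ℝ) : ℂ) *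
      (cubeChargeOf L ν ρ Q X / (cubeMass L ν Φ Q X : ℂ)))
    ((measurable_cubeIdx L ν).comp (measurable_pi_apply 0)) fun Q =>
    (ltg_continuous_branch hL ν Φ hΦ hρ Q).measurable

/-- The local part of a continuous charge is measurable. [folklore] -/
theorem measurable_localOf (hL : 0 < L) (ν : ℕ) (Φ : PeriodicTrialState (m + 1) L)
    (hΦ : ∀ X, Φ.ψ X ≠ 0) (hρ : Continuous ρ) : Measurable (localOf L ν Φ ρ) :=
  hρ.measurable.sub (measurable_coarseOf hL ν Φ hΦ hρ)

/-- `ρ_c · G` is integrable on `cellN` for continuous `G`. [folklore] -/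
theorem ltg_integrableOn_coarseOf_mul (hL : 0 < L) (ν : ℕ) (Φ : PeriodicTrialState (m + 1) L)
    (hΦ : ∀ X, Φ.ψ X ≠ 0) (hρ : Continuous ρ) {G : Config (m + 1) → ℂ} (hG : Continuous G) :
    IntegrableOn (fun X => coarseOf L ν Φ ρ X * G X) (cellN (m + 1) L) :=
  integrableOn_select (F := fun Q X => ((fibrePsi Φ X ^ 2 : ℝ) : ℂ) *
      (cubeChargeOf L ν ρ Q X / (cubeMass L ν Φ Q X : ℂ)) * G X)
    ((measurable_cubeIdx L ν).comp (measurable_pi_apply 0)) fun Q =>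
    integrableOn_cellN ((ltg_continuous_branch hL ν Φ hΦ hρ Q).mul hG) L

/-- `ρ_loc · G` is integrable on `cellN` for continuous `G`. [folklore] -/
theorem ltg_integrableOn_localOf_mul (hL : 0 < L) (ν : ℕ) (Φ : PeriodicTrialState (m + 1) L)
    (hΦ : ∀ X, Φ.ψ X ≠ 0) (hρ : Continuous ρ) {G : Config (m + 1) → ℂ} (hG : Continuous G) :
    IntegrableOn (fun X => localOf L ν Φ ρ X * G X) (cellN (m + 1) L) := by
  have h1 : IntegrableOn (fun X => ρ X * G X) (cellN (m + 1) L) := integrableOn_cellN (hρ.mul hG) L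
  have h2 := ltg_integrableOn_coarseOf_mul hL ν Φ hΦ hρ hG
  exact (h1.sub h2).congr_fun (fun X _ => by simp only [Pi.sub_apply, localOf]; ring)
    (measurableSet_cellN _ L)

/-- `ρ_loc · Πη` is integrable on `cellN`. [folklore] -/
theorem ltg_integrableOn_localOf_mul_blockAvg (hL : 0 < L) (ν : ℕ) (Φ : PeriodicTrialState (m + 1) L)
    (hΦ : ∀ X, Φ.ψ X ≠ 0) (hρ : Continuous ρ) {η : Config (m + 1) → ℂ} (hη : Continuous η) :
    IntegrableOn (fun X => localOf L ν Φ ρ X * cubeAvg L ν η (cubeIdx L ν (X 0)) X) (cellN (m + 1) L) := by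
  refine integrableOn_select (F := fun Q X => (ρ X - ((fibrePsi Φ X ^ 2 : ℝ) : ℂ) *
      (cubeChargeOf L ν ρ Q X / (cubeMass L ν Φ Q X : ℂ))) * cubeAvg L ν η Q X)
    ((measurable_cubeIdx L ν).comp (measurable_pi_apply 0)) fun Q => ?_
  exact integrableOn_cellN ((hρ.sub (ltg_continuous_branch hL ν Φ hΦ hρ Q)).mul
    (continuous_cubeAvg hL ν hη Q)) L

/-! ### Cube neutrality of the local part and the vanishing cross term -/

/-- On the cube `Q` of the fibre through `X` the local part reads `ρ − ψ²c_Q(X)/μ_Q(X)`. [folklore] -/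
theorem localOf_update_of_mem (hL : 0 < L) {ν : ℕ} (Φ : PeriodicTrialState (m + 1) L)
    (ρ : Config (m + 1) → ℂ) {Q : Fin 3 → Fin (ν + 1)} (X : Config (m + 1)) {y : Space}
    (hy : y ∈ cubeSet L ν Q) :
    localOf L ν Φ ρ (Function.update X 0 y) = ρ (Function.update X 0 y) -
      ((fibrePsi Φ (Function.update X 0 y) ^ 2 : ℝ) : ℂ) *
        (cubeChargeOf L ν ρ Q X / (cubeMass L ν Φ Q X : ℂ)) := by
  simp only [localOf, coarseOf, Function.update_self, cubeIdx_of_mem_cubeSet hL hy,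
    cubeChargeOf_update, cubeMass_update]

/-- **Cube neutrality**: `∫_Q ρ_loc(y, X̂) dy = c_Q − (c_Q/μ_Q)·μ_Q = 0`. [folklore] -/
theorem integral_cubeSet_localOf (hL : 0 < L) {ν : ℕ} (Φ : PeriodicTrialState (m + 1) L)
    (hΦ : ∀ X, Φ.ψ X ≠ 0) (hρ : Continuous ρ) (Q : Fin 3 → Fin (ν + 1)) (X : Config (m + 1)) :
    ∫ y in cubeSet L ν Q, localOf L ν Φ ρ (Function.update X 0 y) = 0 := by
  have hu : Continuous fun y : Space => Function.update X 0 y := continuous_const.update 0 continuous_id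
  have hρu : Continuous fun y : Space => ρ (Function.update X 0 y) := hρ.comp hu
  have hψu : Continuous fun y : Space => ((fibrePsi Φ (Function.update X 0 y) ^ 2 : ℝ) : ℂ) :=
    Complex.continuous_ofReal.comp (((continuous_fibrePsi hL Φ hΦ).comp hu).pow 2)
  set κ : ℂ := cubeChargeOf L ν ρ Q X / (cubeMass L ν Φ Q X : ℂ) with hκ
  have hμ0 : (cubeMass L ν Φ Q X : ℂ) ≠ 0 := Complex.ofReal_ne_zero.2 (cubeMass_pos hL ν Φ hΦ Q X).ne'
  calc ∫ y in cubeSet L ν Q, localOf L ν Φ ρ (Function.update X 0 y)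
      = ∫ y in cubeSet L ν Q, (ρ (Function.update X 0 y) -
          ((fibrePsi Φ (Function.update X 0 y) ^ 2 : ℝ) : ℂ) * κ) :=
        setIntegral_congr_fun (measurableSet_cubeSet L ν Q) fun y hy => localOf_update_of_mem hL Φ ρ X hy
    _ = cubeChargeOf L ν ρ Q X - (∫ y in cubeSet L ν Q,
          ((fibrePsi Φ (Function.update X 0 y) ^ 2 : ℝ) : ℂ)) * κ := by
        rw [integral_sub (integrableOn_cubeSet hL Q hρu) ((integrableOn_cubeSet hL Q hψu).mul_const κ),
          integral_mul_const]
        rfl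
    _ = 0 := by
        have hm : ∫ y in cubeSet L ν Q, ((fibrePsi Φ (Function.update X 0 y) ^ 2 : ℝ) : ℂ) =
            (cubeMass L ν Φ Q X : ℂ) := by
          rw [cubeMass]
          exact integral_ofReal
        rw [hm, hκ, mul_div_cancel₀ _ hμ0, sub_self]

/-- Per fibre the cross term vanishes: `∫_cell ρ_loc(y, X̂)·Πη(y, X̂) dy = Σ_Q ⨍_Qη · ∫_Q ρ_loc = 0`.
[folklore] -/
theorem ltg_integral_cell_localOf_mul_blockAvg (hL : 0 < L) {ν : ℕ} (Φ : PeriodicTrialState (m + 1) L)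
    (hΦ : ∀ X, Φ.ψ X ≠ 0) (hρ : Continuous ρ) (η : Config (m + 1) → ℂ) (X : Config (m + 1)) :
    ∫ y in cell L, localOf L ν Φ ρ (Function.update X 0 y) *
      cubeAvg L ν η (cubeIdx L ν (Function.update X 0 y 0)) (Function.update X 0 y) = 0 := by
  have hu : Continuous fun y : Space => Function.update X 0 y := continuous_const.update 0 continuous_id
  -- on the cube `Q` the integrand is `(ρ - F_Q)(X⁰ʸ) * ⨍_Q η`, continuous
  have hbranch : ∀ Q : Fin 3 → Fin (ν + 1), ∀ y ∈ cubeSet L ν Q,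
      localOf L ν Φ ρ (Function.update X 0 y) * cubeAvg L ν η (cubeIdx L ν (Function.update X 0 y 0)) (Function.update X 0 y) =
        (ρ (Function.update X 0 y) - ((fibrePsi Φ (Function.update X 0 y) ^ 2 : ℝ) : ℂ) *
          (cubeChargeOf L ν ρ Q X / (cubeMass L ν Φ Q X : ℂ))) * cubeAvg L ν η Q X := by
    intro Q y hy
    rw [localOf_update_of_mem hL Φ ρ X hy, blockAvg_update hL X hy]
  have hcontQ : ∀ Q : Fin 3 → Fin (ν + 1), Continuous fun y : Space =>
      (ρ (Function.update X 0 y) - ((fibrePsi Φ (Function.update X 0 y) ^ 2 : ℝ) : ℂ) *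
        (cubeChargeOf L ν ρ Q X / (cubeMass L ν Φ Q X : ℂ))) * cubeAvg L ν η Q X := fun Q =>
    (((hρ.comp hu).sub ((Complex.continuous_ofReal.comp
      (((continuous_fibrePsi hL Φ hΦ).comp hu).pow 2)).mul continuous_const))).mul continuous_const
  have hint : ∀ Q, IntegrableOn (fun y => localOf L ν Φ ρ (Function.update X 0 y) *
      cubeAvg L ν η (cubeIdx L ν (Function.update X 0 y 0)) (Function.update X 0 y)) (cubeSet L ν Q) := fun Q =>
    (integrableOn_cubeSet hL Q (hcontQ Q)).congr_fun (fun y hy => (hbranch Q y hy).symm)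
      (measurableSet_cubeSet L ν Q)
  rw [integral_cell_eq_sum hL ν hint]
  refine Finset.sum_eq_zero fun Q _ => ?_
  calc ∫ y in cubeSet L ν Q, localOf L ν Φ ρ (Function.update X 0 y) *
        cubeAvg L ν η (cubeIdx L ν (Function.update X 0 y 0)) (Function.update X 0 y)
      = ∫ y in cubeSet L ν Q, localOf L ν Φ ρ (Function.update X 0 y) * cubeAvg L ν η Q X :=
        setIntegral_congr_fun (measurableSet_cubeSet L ν Q) fun y hy => by rw [blockAvg_update hL X hy]
    _ = 0 := by rw [integral_mul_const, integral_cubeSet_localOf hL Φ hΦ hρ Q X, zero_mul]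

/-- **The cross term vanishes**: `∫_{cellN} ρ_loc · Πη = 0` (Bochner fibre Fubini and cube
neutrality). [folklore] -/
theorem integral_localOf_mul_blockAvg (hL : 0 < L) {ν : ℕ} (Φ : PeriodicTrialState (m + 1) L)
    (hΦ : ∀ X, Φ.ψ X ≠ 0) (hρ : Continuous ρ) {η : Config (m + 1) → ℂ} (hη : Continuous η) :
    ∫ X in cellN (m + 1) L, localOf L ν Φ ρ X * cubeAvg L ν η (cubeIdx L ν (X 0)) X = 0 := by
  have hF := Literature.MathematicalPhysics.QuantumManyBody.JelliumBoseGas.integral_cellN_integral_cell_update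
    0 (ltg_integrableOn_localOf_mul_blockAvg hL ν Φ hΦ hρ hη)
  have hzero : ∫ X in cellN (m + 1) L, ∫ y in cell L, localOf L ν Φ ρ (Function.update X 0 y) *
      cubeAvg L ν η (cubeIdx L ν (Function.update X 0 y 0)) (Function.update X 0 y) = 0 := by
    simp_rw [ltg_integral_cell_localOf_mul_blockAvg hL Φ hΦ hρ η]
    exact integral_zero _ _
  rw [hzero] at hF
  have hL3 : (L ^ 3 : ℝ) ≠ 0 := by positivity
  exact (smul_eq_zero.1 hF.symm).resolve_left hL3

end LocalToGlobal


end Summit.AtomisticToContinuum.BoseEinsteinCondensation.Cruxes.FibreConductance.ConditionalLawPoincare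

end
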